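import Summits.HodgeConjecture.HodgeConjecture.Theorems.Ring2HypothesesCMPivot
import Summits.HodgeConjecture.HodgeConjecture.Theorems.Ring2TransportWeilTypeExactness
import Summits.HodgeConjecture.HodgeConjecture.Theorems.Ring2BindersAbelianSchemeVHCCMGerm
import Summits.HodgeConjecture.HodgeConjecture.Theorems.Ring2TransportSemiregularGerm
import Literature.AlgebraicGeometry.Motives.AbelianFibresOfAbelianFibre
import HarnessLib

/-!
# HSemireg venture · general structure (G4) — the WIRING: uniform semiregularity at CM fibres ⟹ `HC_AV`, modulo NAMED hypotheses

HONEST FRAMING (speculative tier of cell `pub-hsemireg`, team «general structure», seat G4; page 1, verbatim the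
cell's wording rule): **nothing here says `HC_AV` or `HC_CM` is proved; every implication carries its named
hypotheses.** This file is the Lean INDEX of an implication chain. It asserts NOTHING about any explicit variety,
contains no `sorry`, no new axiom, and uses only `propext`, `Classical.choice`, `Quot.sound`. `HC_CM` (the Hodge
conjecture for complex abelian varieties of CM type) is the OPEN route item
`Summit.HodgeConjecture.HodgeConjecture.Theses.RankFourFaces.CMAbelianHodge` (stmt-HodgeConjecture-3052) and is
ALWAYS an explicit binder `(hCM : …)`; `HC_AV` is `Theses.PadicSemiregularLift.HodgeAbelianVarieties`
(stmt-HodgeConjecture-1333, `∀ A : AbelianVariety ℂ, HodgeConjectureFor A.dim A.X`). Ring 2's kernel theorems are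
used BY NAME (no restatement): `Ring2Transport.hodgeAbelianVarieties_iff_hodgeWeilType` (`HC_AV ↔ HodgeWeilType`,
file `Ring2TransportWeilTypeExactness.lean`), `Ring2.Hypotheses.hc_av_of_hc_cm_of_cmAnchoredFamilies_of_localVHCAtCM`
(the CM pivot, file `Ring2HypothesesCMPivot.lean`), `Ring2.Hypotheses.hc_av_iff_hc_cm_and_cmToAbelian`
(`Ring2Hypotheses.lean`).

## The statement the coordinator asked for, and how it reads in the kernel

  (uniform semiregularity at CM points of every component) ∧ HC_CM ∧ (cited transfer chain) ⟹ HodgeWeilType ↔ HC_AV.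

* "every component" — a Hodge class `c` on ANY complex abelian variety `A` lies on a component of its Hodge locus;
  Deligne 1982 Prop. 6.1 / Mumford 1969 (THEOREM IN PRINT) puts `A` in a smooth projective family of abelian varieties
  over a smooth irreducible quasi-projective base along which `c` extends to a global class `G`, fibrewise rational
  `(p,p)`, with a CM fibre `A₀ = 𝒳_{s₀}`. In Lean: ring 2's `CMAnchoredFamilies` (OPEN in Lean, printed), supplied
  by the refereed Literature fact `Deligne1982.deligne1982_cmDenseMumfordTateFamilies`
  (`Ring2.Deform.cmAnchoredFamilies_of_deligne1982`). The Weil-type components `(K, (n,n), δ)` that the team's tables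
  G1–G3 enumerate are the SUB-CASE `G ∈` Weil plane (§4).
* "HC_CM" — makes `G|_{A₀}` ALGEBRAIC at the CM fibre. Binder `hCM`, consumed exactly once (inside the CM pivot).
* "uniform semiregularity" — THE TEAM'S HYPOTHESIS, typed here as `UniformSemiregularSheafLiftAtCM C` (§1): at every
  such CM fibre the algebraic class `G|_{𝒳_{s₀}}` is a `ℂ`-combination of Chern characters `ch_p(E_i)` of finite
  locally free sheaves `E_i` on the fibre which are `I_i`-semiregular in the sense of Buchweitz–Flenner (`I_i ∋ p`),
  whose `ch_q(E_i)`, `q ∈ I_i`, stay of type `(q,q)` along the family near `s₀` — EXACTLY the input package of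
  Buchweitz–Flenner 2003 Thm. 5.1 (tree NAMED FACT `BuchweitzFlenner2003_variationalHodge_ISemiregular`, refereed,
  unformalised). Status: OURS, SPECULATIVE, OPEN; not a Literature fact; no statement of this shape is in print (the
  closest print has the semiregular sheaf GIVEN: Bloch 1972 Thm. 7.1, Buchweitz–Flenner 2003 Thm. 5.1, Markman's
  Question 11.4 sentence 1). It is the all-families / all-codimensions form of ring 2's Weil-confined
  `Ring2Transport.SemiregularChernLiftAtCMQuadratic` (which carries the referee label "plausibly false as a
  `∀`-statement"; the same label applies here and is the red team's target).
* "cited transfer chain" — (3a) Buchweitz–Flenner Thm. 5.1 (germ: algebraic on the fibres over a Euclidean-open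
  `W ∋ s₀`), (3c) germ ⟹ whole base: the algebraicity locus is a countable union of closed algebraic subsets
  (Hilbert schemes; Charles–Schnell Prop. 11.3.11, proof) + Baire + irreducible base — KERNEL-PROVED inside ring 2's
  CM pivot, no hypothesis; (3b) "deformations of an abelian variety are abelian" is NOT needed on the sheaf row
  (the Hodge condition travels with the lift); it IS needed on the on-path rows of §3 (Catanese 2002, named fact
  `Motives.catanese2002_abelianFibres_of_abelianFibre`).

## Rows (kernel-checked)

| row | theorem | hypotheses (each a NAMED `Prop`) | conclusion |
|---|---|---|---|
| G4-1 | `localVHCAtCM_of_buchweitzFlenner_of_uniformSheafLift` | BF 5.1 (fact), `UniformSemiregularSheafLiftAtCM C` (ours) | `LocalVHCAtCM` (ring 2's CM-germ leaf) |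
| G4-2 | `hc_av_of_hc_cm_of_cmAnchoredFamilies_of_buchweitzFlenner_of_uniformSheafLift` | `HC_CM`, `CMAnchoredFamilies`, BF 5.1, uniform lift | `HC_AV` |
| G4-2′ | `hc_av_of_hc_cm_of_deligne1982_of_buchweitzFlenner_of_uniformSheafLift` | `HC_CM`, Deligne 1982 Prop. 6.1 (fact), BF 5.1 (fact), uniform lift | `HC_AV` |
| G4-3 | `hodgeWeilType_of_hc_cm_of_deligne1982_of_buchweitzFlenner_of_uniformSheafLift` | same | `Ring2Transport.HodgeWeilType` |
| G4-4 | `cmToAbelian_of_cmAnchoredFamilies_of_buchweitzFlenner_of_uniformSheafLift` | no `HC_CM` | `Theses.RankFourFaces.CMToAbelian` (stmt-16267: `HC_CM → HC_AV`) |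
| G4-5 | `generalStructure_position` | — | what the uniform lift is sufficient FOR: exactly ring 2's missing transport `(HC_CM → LocalVHCAtCM) ↔ CMToAbelian ↔ (HC_CM → HodgeWeilType)` |

VACUITY LEDGER (for the red team; T5-style): (i) every hypothesis EXCEPT the uniform lift is either a binder for
an open ITEM implied by the summit (`HC_CM`: `Ring2.Deform.HC_CM_of_hodgeConjecture`) or a refereed printed theorem
typed as a named fact (Deligne 1982 Prop. 6.1; Buchweitz–Flenner 2003 Thm. 5.1; Catanese 2002 Thm. 4.1) — so
`False` is derivable from the bundle only if it is derivable from `HodgeConjecture ∧` print `∧` uniform lift;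
(ii) the uniform lift has NO on-path lemma (its conclusion asserts sheaves; `HodgeConjecture` does not imply it) —
it is genuinely extra; (iii) its antecedents are jointly satisfiable (ring 2's
`CMPivot.Stubs.localVHCAtCM_hypotheses_nonempty`, used by name — the antecedents are literally those of
`LocalVHCAtCM`), so it is not vacuously true; (iv) it is NOT refuted by the tree's weak-criterion counterexample
(`HodgeTheory/SemiregularityWeakCriterionAbelianCounterexample*.lean` exhibits ONE non-semiregular sheaf, not a class
without semiregular presentation); (v) first-order consistency: if `E` is `I`-semiregular and `ch_I(E)` stays Hodge
then `E` deforms (BF), so ALL `ch_k(E)` stay Hodge — a semiregular presentation at a CM point `E^{2n}` of a Weil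
family can involve no sheaf whose Chern classes use the extra CM divisors (the cell's filter S2c; the no-go census
of `WeilClassesBlochSeed.lean`); the hypothesis survives this only through sheaves/cycles that "forget" the CM
divisors — which is what the team's engines test. Numbers, not adjectives: 1 new `@[conjecture] def`, 8 theorems,
0 sorries, 0 new facts.

## References (bib keys)

BuchweitzFlenner2003 (§5 Thm. 5.1, Def. 4.1), Bloch1972Semiregularity (Thm. 7.1, 7.4), Deligne1982HodgeCycles
(Prop. 6.1; §4 Lemma 4.5, Remark 4.10), CharlesSchnell2014Notes (Conj. 11.3.1, Prop. 11.3.11, Thm. 11.5.11),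
Mumford1969NoteShimura (§3), Catanese2002DeformationTypes (§4 Thm. 4.1, 4.6), vanGeemen1994HodgeAV (4.9–4.11),
Markman2025SurveySecant (Question 11.4, §12; preprint, unrefereed — statements only), VoisinHodgeI2002 (§9.2.1),
VoisinHodgeII2003 (§3.1.2, §5.3.3).
-/

noncomputable section

open CategoryTheory
open Literature.AlgebraicGeometry Literature.AlgebraicGeometry.Motives
open Literature.AlgebraicGeometry.HodgeTheory
open Literature.AlgebraicGeometry.Deligne1982 (deligne1982_cmDenseMumfordTateFamilies)

namespace Summit.Ventures.HSemireg.GeneralStructure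

open Summit.HodgeConjecture.HodgeConjecture
open Summit.HodgeConjecture.HodgeConjecture.Ring2.Hypotheses (CMAnchoredFamilies LocalVHCAtCM
  hc_av_of_hc_cm_of_cmAnchoredFamilies_of_localVHCAtCM cmToAbelian_of_cmAnchoredFamilies_of_localVHCAtCM
  hc_av_iff_hc_cm_and_cmToAbelian)
open Summit.HodgeConjecture.HodgeConjecture.Ring2Transport (HodgeWeilType pathIn transportFun_pathIn_mono
  hodgeAbelianVarieties_iff_hodgeWeilType cmToAbelian_iff_hodgeWeilType_of_cmAbelianHodge)

/-! ### §0 The CM-pivot vocabulary (verbatim ring 2's local notations, so that the hypothesis below has LITERALLY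
the antecedents of `Ring2.Hypotheses.LocalVHCAtCM`) -/

/-- `IsCM[A]` — CM type in the eigenvalue typing (verbatim `Ring2HypothesesCMPivot`). Local notation only. -/
local notation3 (prettyPrint := false) "IsCM[" A "]" =>
  ∃ (ψ : A ⟶ A) (μ : Fin (2 * AbelianVariety.dim A) → ℂ), Function.Injective μ ∧
    ∀ i, Module.End.HasEigenvalue (HodgeTheory.complexBetti.map ψ.hom.hom.hom 1).hom (μ i)

/-- `QProj[X]` — `X` quasi-projective over `ℂ` (inlined body of `HodgeTheory.IsQuasiProjectiveOver X`).
Local notation only. -/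
local notation3 (prettyPrint := false) "QProj[" X "]" =>
  ∃ (P : SchemeOver ℂ) (j : X ⟶ P), IsProjectiveOver P ∧ AlgebraicGeometry.IsOpenImmersion j.left

/-- `FibreIncl[f, B, e, s]` — `e` presents `B` as the fibre of `f` over `s`. Local notation only. -/
local notation3 (prettyPrint := false) "FibreIncl[" f ", " B ", " e ", " s "]" =>
  ∃ i : AbelianVariety.X B ≅ fiberOver f s, e = CategoryStruct.comp i.hom (fiberι f s)

/-- `HodgeAlong[S, 𝒳, f, G, p]` — `G` is rational `(p,p)` on every fibre presented as an abelian variety.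
Local notation only. -/
local notation3 (prettyPrint := false) "HodgeAlong[" S ", " 𝒳 ", " f ", " G ", " p "]" =>
  ∀ (B : AbelianVariety ℂ) (eB : AbelianVariety.X B ⟶ 𝒳) (u : ComplexPoints S),
    FibreIncl[f, B, eB, u] →
      HodgeTheory.IsRationalClass (HodgeTheory.complexBetti.map eB (2 * p) G) ∧
      HodgeTheory.IsOfHodgeType B.dim B.X (2 * p) p p (HodgeTheory.complexBetti.map eB (2 * p) G)

/-! ### §1 The team's hypothesis: a UNIFORM semiregular (Buchweitz–Flenner) presentation of algebraic classes at
CM fibres of families of abelian varieties -/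

/-- **`UniformSemiregularSheafLiftAtCM C` — UNIFORM SEMIREGULARITY AT CM POINTS, sheaf form (the «general structure»
hypothesis of cell `pub-hsemireg`, team G; OURS, SPECULATIVE, OPEN — NOT a Literature fact).** In EXACTLY the
antecedents of ring 2's CM-germ leaf `Ring2.Hypotheses.LocalVHCAtCM` (a smooth projective family `f : 𝒳 ⟶ S` of
relative dimension `m`, `𝒳` and `S` quasi-projective, `S` smooth irreducible, a CM abelian fibre `A₀ ≅ 𝒳_{s₀}`
(eigenvalue typing `IsCM[A₀]`), a global class `G ∈ H^{2p}(𝒳(ℂ); ℂ)` rational `(p,p)` on every fibre presented as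
an abelian variety, whose value on `A₀` is ALGEBRAIC — which is what `HC_CM` delivers): there are a Euclidean-open
`U ∋ s₀`, finitely many finite locally free sheaves `E_i` on THE fibre `𝒳_{s₀}` with finite degree sets `I_i ∋ p`
such that `E_i` is `I_i`-semiregular in the sense of Buchweitz–Flenner (`IsISemiregular`: joint injectivity of
`(σ_{q})_{q+1 ∈ I_i}` on `Ext²(E_i, E_i)`), complex coefficients `c_i` with `G|_{𝒳_{s₀}} = Σ_i c_i · ch_p(E_i)` for
the Chern character theory `C`, and, for every `i` and `q ∈ I_i`, the flat transport of `ch_q(E_i)` along every path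
in `U` from `s₀` is of type `(q,q)` — exactly the hypothesis package of the tree fact
`BuchweitzFlenner2003_variationalHodge_ISemiregular` (Compositio Math. 137 (2003) Thm. 5.1), `ℂ`-linearly extended.
It is the all-families, all-codimensions form of ring 2's `Ring2Transport.SemiregularChernLiftAtCMQuadratic`
(Weil-confined, quadratic). WHAT THE TEAM COMPUTES (G1–G3): instances of this statement on the Weil-type components
`(K = ℚ(√-d), (n,n), δ)` at CM points `E^{2n}`-type, with torus-stable representatives, `n = 2, …, 5`. CLOSEST PRINT
— all with the semiregular sheaf GIVEN, none producing it from algebraicity —: Bloch, Invent. Math. 17 (1972)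
Thm. (7.1); Buchweitz–Flenner 2003 Thm. 5.1; Markman, arXiv:2509.23403 Question 11.4 SENTENCE 1 (open; sentence 2,
the weak criterion, is REFUTED for abelian varieties of dimension ≥ 3, tree
`SemiregularityWeakCriterionAbelianCounterexampleFull`). HONEST LABEL (inherited from ring 2's referee ruling ref1 F5
on the Weil-confined form): PLAUSIBLY FALSE AS A `∀`-STATEMENT — obstructed representatives are generic; the
preferred form is a per-family witness; NOT a case of HC (its conclusion asserts sheaves), so no on-path lemma.
NOT asserted anywhere. CAVEAT C1 (transport review T-R4, 2026-08-22; numbers, not adjectives): `IsISemiregular` and the tree's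
rendering of Buchweitz–Flenner Thm. 5.1 (`BuchweitzFlenner2003_variationalHodge_ISemiregular`) are for FINITE LOCALLY FREE `E_i`
ONLY (gap G44: the coherent-sheaf / perfect-complex versions — BF 2003 for modules, Pridham 2024, Perry 2026 — are not rendered);
ideal sheaves `I_Z`, `I_Z ⊠ I_{Z'}^∨` and secant complexes do NOT instantiate this statement as typed — they need a locally free
(twisted) replacement, the lci door (`UniformBlochLiftAtCM`, Bloch 7.4), or an explicitly labelled BF-for-complexes binder; never a
hidden conversion. (Docstring revised 2026-08-22, words only, no declaration changed.)
SHADOW AND DOMAIN (RED-GS GS-9 / GS-10 R6, 2026-08-22): (i) restricted to the point base `Spec ℂ` this statement ENTAILS the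
deformation-free shadow (★) «every rational algebraic `(p,p)` class on every CM abelian variety is a `ℂ`-combination of `ch_p` of
`I`-semiregular finite locally free sheaves» (kernel: `existsAnchor_pointBase`, `GeneralStructureWiringFamilies.lean`), which is TRUE FOR
FREE at divisor-generated CM points such as `E^{2n}` (ample line bundles, hard Lefschetz) — table rows there are NO evidence for (★); its
content is the exceptional classes, `2 ≤ p ≤ m − 2`; (ii) DOMAIN: the `∀` ranges over ALL CM fibres of ALL admissible families (simple CM
points, special sub-families, 0-dimensional bases), while the team's evidence is product CM points, Weil classes, `n ≤ 5`; (iii) HIDDEN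
PARAMETER (red-1 V2-L4): the statement and its rows are parametrised by `C : ChernCharacterBetti`, of which the tree vendors NO instance
(a construction-type input of every sheaf row; the cycle form has none). (Docstring revised 2026-08-22, words only.)
[cite: BuchweitzFlenner2003, §5 Thm. 5.1 and Def. 4.1]
[cite: Bloch1972Semiregularity, Thm. (7.1) and (7.4)]
[cite: Markman2025SurveySecant, Question 11.4 sentence 1 and §12 (preprint / ICM 2026 lecture, unrefereed)]
[cite: Pridham2024Semiregularity, Cor. 2.25 and Rem. 2.27 (perfect complexes; not rendered, gap G44)] [status: open, speculative] -/
@[conjecture] def UniformSemiregularSheafLiftAtCM (C : ChernCharacterBetti) : Prop :=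
  ∀ (S 𝒳 : SchemeOver ℂ) (f : 𝒳 ⟶ S) (m p : ℕ) (G : HodgeTheory.complexBetti 𝒳 (2 * p))
    (s₀ : ComplexPoints S) (A₀ : AbelianVariety ℂ) (e₀ : A₀.X ⟶ 𝒳),
    QProj[𝒳] → QProj[S] → AlgebraicGeometry.Smooth S.hom → IrreducibleSpace S.left →
    IsSmoothProjectiveFamily f m →
    FibreIncl[f, A₀, e₀, s₀] → IsCM[A₀] →
    HodgeTheory.complexBetti.map e₀ (2 * p) G ∈ HodgeTheory.algebraicClasses A₀.X p →
    HodgeAlong[S, 𝒳, f, G, p] →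
    ∃ (U : Set (ComplexPoints S)) (hs₀ : s₀ ∈ U), IsOpen U ∧
      ∃ (r : ℕ) (c : Fin r → ℂ) (E : Fin r → (fiberOver f s₀).left.Modules)
        (hE : ∀ i, IsFiniteLocallyFree (E i)) (Ideg : Fin r → Finset ℕ),
        (∀ i, p ∈ Ideg i) ∧ (∀ i, IsISemiregular (hE i) {q | q + 1 ∈ Ideg i}) ∧
        complexBetti.map (fiberι f s₀) (2 * p) G = ∑ i, c i • C.ch (fiberOver f s₀) (E i) p ∧
        ∀ (hU : IsCohomologicallyLocallyTrivialOn f U) (i : Fin r), ∀ q ∈ Ideg i,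
          ∀ (t : U) (γ : Path.Homotopic.Quotient (⟨s₀, hs₀⟩ : U) t),
            IsOfHodgeType m (fiberOver f t.1) (2 * q) q q
              (transportFun f (2 * q) hU γ (C.ch (fiberOver f s₀) (E i) q))

/-! ### §2 Row G4-1: the refereed germ theorem transports the uniform lift into ring 2's CM-germ leaf -/

/-- **G4-1 — `LocalVHCAtCM` from the uniform semiregular sheaf lift and Buchweitz–Flenner's theorem (kernel-checked;
literature input REFEREED; no `HC_CM`, no preprint).** At a CM-charted algebraic fibre `s₀`: write
`G|_{s₀} = Σ c_i ch_p(E_i)` (the hypothesis); the whole base is cohomologically locally trivial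
(`isCohomologicallyLocallyTrivialOn_univ_of_isQuasiProjectiveOver`, Ehresmann), so Buchweitz–Flenner Thm. 5.1 gives
opens `W_i ∋ s₀` over which the transports of `ch_p(E_i)` are algebraic; on the path component `V` of `s₀` in
`U ∩ ⋂ W_i` (open: `S(ℂ)` is locally path connected, `locallyPathConnectedSpace_complexPoints_of_smooth`) every `t` is
joined to `s₀` by a path `γ ⊂ V`, and `G|_{𝒳_t} = γ_*(G|_{s₀}) = Σ c_i γ_*(ch_p E_i)` (restrictions of global classes
are flat, `transportFun_map_fiberι`; transport is `ℂ`-linear) is algebraic. Proof pattern = ring 2's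
`Ring2Transport.localWeilVHCAtCMQuadratic_of_semiregularChernLift` with the Weil confinement removed. The CM
hypothesis and the chart are IDLE in this row (they only restrict WHERE the lift is asked).
[cite: BuchweitzFlenner2003, §5 Thm. 5.1] [cite: VoisinHodgeI2002, §9.2.1] [cite: VoisinHodgeII2003, §3.1.2] -/
theorem localVHCAtCM_of_buchweitzFlenner_of_uniformSheafLift (C : ChernCharacterBetti)
    (hBF : BuchweitzFlenner2003_variationalHodge_ISemiregular)
    (hL : UniformSemiregularSheafLiftAtCM C) : LocalVHCAtCM := by
  intro S 𝒳 f m p G s₀ A₀ e₀ h𝒳 hS hsm hirr hf hA₀ hCM halg hG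
  obtain ⟨U, hs₀U, hUo, r, c, E, hE, Ideg, hpI, hsr, hsum, hHodge⟩ :=
    hL S 𝒳 f m p G s₀ A₀ e₀ h𝒳 hS hsm hirr hf hA₀ hCM halg hG
  have hqS : IsQuasiProjectiveOver S := hS
  have hU : IsCohomologicallyLocallyTrivialOn f U :=
    (isCohomologicallyLocallyTrivialOn_univ_of_isQuasiProjectiveOver f hf hqS hsm).mono (Set.subset_univ U) hUo
  -- Buchweitz–Flenner, sheaf by sheaf
  have hBFi : ∀ i : Fin r, ∃ (Wi : Set (ComplexPoints S)) (hWo : IsOpen Wi) (hW₀ : s₀ ∈ Wi) (hWU : Wi ⊆ U),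
      ∀ (t : Wi) (γ : Path.Homotopic.Quotient (⟨s₀, hW₀⟩ : Wi) t),
        transportFun f (2 * p) (hU.mono hWU hWo) γ (C.ch (fiberOver f s₀) (E i) p) ∈
          algebraicClasses (fiberOver f t.1) p := by
    intro i
    obtain ⟨Wi, hWo, hW₀, hWU, h⟩ := hBF C f m hf hsm hU ⟨s₀, hs₀U⟩ (E i) (hE i) (Ideg i) (hsr i)
      (fun q hq t γ ↦ hHodge hU i q hq t γ)
    exact ⟨Wi, hWo, hW₀, hWU, fun t γ ↦ h p (hpI i) t γ⟩
  choose Wi hWio hW₀i hWiU hWialg using hBFi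
  -- the path component of `s₀` in `U ∩ ⋂ Wi`
  haveI := hsm
  haveI : LocallyPathConnectedSpace (ComplexPoints S) := locallyPathConnectedSpace_complexPoints_of_smooth S
  set W₀ : Set (ComplexPoints S) := U ∩ ⋂ i, Wi i with hW₀def
  have hW₀o : IsOpen W₀ := hUo.inter (isOpen_iInter_of_finite hWio)
  have hs₀W₀ : s₀ ∈ W₀ := ⟨hs₀U, Set.mem_iInter.2 hW₀i⟩
  refine ⟨pathComponentIn W₀ s₀, hW₀o.pathComponentIn s₀, mem_pathComponentIn_self hs₀W₀, fun t ht ↦ ?_⟩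
  have hJ : JoinedIn W₀ s₀ t := ht
  set γ₀ : Path s₀ t := hJ.somePath
  have hγ : ∀ ρ, γ₀ ρ ∈ W₀ := hJ.somePath_mem
  have hγU : ∀ ρ, γ₀ ρ ∈ U := fun ρ ↦ (hγ ρ).1
  have hγi : ∀ i ρ, γ₀ ρ ∈ Wi i := fun i ρ ↦ Set.mem_iInter.1 (hγ ρ).2 i
  -- `G|_{𝒳_t}` is the transport of `G|_{𝒳_{s₀}}` along `γ₀` (in `U`)
  have hGt : complexBetti.map (fiberι f t) (2 * p) G =
      transportFun f (2 * p) hU ⟦pathIn γ₀ U hγU⟧ (complexBetti.map (fiberι f s₀) (2 * p) G) :=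
    (transportFun_map_fiberι f (2 * p) hU ⟦pathIn γ₀ U hγU⟧ G).symm
  have hlin : transportFun f (2 * p) hU ⟦pathIn γ₀ U hγU⟧ (∑ i, c i • C.ch (fiberOver f s₀) (E i) p) =
      ∑ i, c i • transportFun f (2 * p) hU ⟦pathIn γ₀ U hγU⟧ (C.ch (fiberOver f s₀) (E i) p) := by
    simp only [← transportLinear_apply, map_sum, map_smul]
  rw [hGt, hsum, hlin]
  refine Submodule.sum_mem _ fun i _ ↦ Submodule.smul_mem _ (c i) ?_
  have hi := hWialg i ⟨t, hγi i 1 |> fun h ↦ γ₀.target ▸ h⟩ ⟦pathIn γ₀ (Wi i) (hγi i)⟧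
  rw [transportFun_pathIn_mono f (2 * p) hU (hWiU i) (hWio i) γ₀ (hγi i)] at hi
  exact hi

/-! ### §3 Rows G4-2 … G4-4: the end statement reads `HC_AV` (equivalently `HodgeWeilType`) modulo named hypotheses -/

/-- **G4-2 — `HC_CM ∧ CMAnchoredFamilies ∧ [Buchweitz–Flenner 5.1] ∧ UniformSemiregularSheafLiftAtCM ⟹ HC_AV`**
(kernel-checked composition of G4-1 with ring 2's CM pivot `hc_av_of_hc_cm_of_cmAnchoredFamilies_of_localVHCAtCM`,
whose germ-to-global step — the algebraicity locus is a countable union of closed algebraic subsets of the irreducible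
base — is proved in the tree). `HC_CM` is load-bearing (it makes the CM fibre an algebraic anchor) and is consumed
exactly once. CONDITIONAL on: `HC_CM` (open item), `CMAnchoredFamilies` (Deligne 1982 Prop. 6.1 — theorem in print,
hypothesis in Lean), Buchweitz–Flenner Thm. 5.1 (refereed named fact), and the team's uniform lift (speculative).
[cite: Deligne1982HodgeCycles, Prop. 6.1] [cite: BuchweitzFlenner2003, §5 Thm. 5.1]
[cite: CharlesSchnell2014Notes, Prop. 11.3.11 (proof)] -/
theorem hc_av_of_hc_cm_of_cmAnchoredFamilies_of_buchweitzFlenner_of_uniformSheafLift (C : ChernCharacterBetti)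
    (hCM : Theses.RankFourFaces.CMAbelianHodge) (hMT : CMAnchoredFamilies)
    (hBF : BuchweitzFlenner2003_variationalHodge_ISemiregular) (hL : UniformSemiregularSheafLiftAtCM C) :
    Theses.PadicSemiregularLift.HodgeAbelianVarieties :=
  hc_av_of_hc_cm_of_cmAnchoredFamilies_of_localVHCAtCM hCM hMT
    (localVHCAtCM_of_buchweitzFlenner_of_uniformSheafLift C hBF hL)

/-- **G4-2′ — the same with the anchors supplied by PRINT**: `HC_CM ∧ [Deligne 1982 Prop. 6.1, dense form = Charles–Schnell
Thm. 11.5.11] ∧ [Buchweitz–Flenner 5.1] ∧ UniformSemiregularSheafLiftAtCM ⟹ HC_AV`. Every hypothesis but the first and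
the last is a refereed Literature fact typed as a named `Prop` (`Deligne1982.deligne1982_cmDenseMumfordTateFamilies`
through `Ring2.Deform.cmAnchoredFamilies_of_deligne1982`; `BuchweitzFlenner2003_variationalHodge_ISemiregular`).
THIS is the end statement of seat G4: **`HC_AV` modulo (`HC_CM`, two printed theorems, the team's uniform lift)**.
[cite: Deligne1982HodgeCycles, Prop. 6.1] [cite: CharlesSchnell2014Notes, Thm. 11.5.11]
[cite: BuchweitzFlenner2003, §5 Thm. 5.1] -/
theorem hc_av_of_hc_cm_of_deligne1982_of_buchweitzFlenner_of_uniformSheafLift (C : ChernCharacterBetti)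
    (hCM : Theses.RankFourFaces.CMAbelianHodge) (hD : deligne1982_cmDenseMumfordTateFamilies)
    (hBF : BuchweitzFlenner2003_variationalHodge_ISemiregular) (hL : UniformSemiregularSheafLiftAtCM C) :
    Theses.PadicSemiregularLift.HodgeAbelianVarieties :=
  hc_av_of_hc_cm_of_cmAnchoredFamilies_of_buchweitzFlenner_of_uniformSheafLift C hCM
    (Ring2.Deform.cmAnchoredFamilies_of_deligne1982 hD) hBF hL

/-- **G4-3 — the coordinator's phrasing: the bundle gives `HodgeWeilType`** (the Hodge conjecture for EVERY complex
abelian variety of Weil type — all `K = ℚ(√-d)`, all `2n`, all discriminants, ALL members; ring 2's W∞), by ring 2's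
EXACTNESS theorem `Ring2Transport.hodgeAbelianVarieties_iff_hodgeWeilType : HC_AV ↔ HodgeWeilType` (every abelian
`T` is a factor of the Weil-type split square `(T × T, Φ_d)`, Deligne LNM 900 §4). Read together with G4-2′ the END
STATEMENT is `HC_AV`; `HodgeWeilType` is not a proper intermediate. [cite: Deligne1982HodgeCycles, §4 Lemma 4.5 and Remark 4.10]
[cite: vanGeemen1994HodgeAV, 4.9–4.11] [cite: BuchweitzFlenner2003, §5 Thm. 5.1] -/
theorem hodgeWeilType_of_hc_cm_of_deligne1982_of_buchweitzFlenner_of_uniformSheafLift (C : ChernCharacterBetti)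
    (hCM : Theses.RankFourFaces.CMAbelianHodge) (hD : deligne1982_cmDenseMumfordTateFamilies)
    (hBF : BuchweitzFlenner2003_variationalHodge_ISemiregular) (hL : UniformSemiregularSheafLiftAtCM C) :
    HodgeWeilType :=
  hodgeAbelianVarieties_iff_hodgeWeilType.1
    (hc_av_of_hc_cm_of_deligne1982_of_buchweitzFlenner_of_uniformSheafLift C hCM hD hBF hL)

/-- **… and composed back: `HodgeWeilType ↔ HC_AV`, so the bundle's `HodgeWeilType` IS `HC_AV`** (the composition the
seat was asked to display; both directions are ring 2's). [cite: Deligne1982HodgeCycles, §4 Lemma 4.5 and Remark 4.10] -/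
theorem hc_av_of_hodgeWeilType_of_bundle (C : ChernCharacterBetti)
    (hCM : Theses.RankFourFaces.CMAbelianHodge) (hD : deligne1982_cmDenseMumfordTateFamilies)
    (hBF : BuchweitzFlenner2003_variationalHodge_ISemiregular) (hL : UniformSemiregularSheafLiftAtCM C) :
    Theses.PadicSemiregularLift.HodgeAbelianVarieties :=
  hodgeAbelianVarieties_iff_hodgeWeilType.2
    (hodgeWeilType_of_hc_cm_of_deligne1982_of_buchweitzFlenner_of_uniformSheafLift C hCM hD hBF hL)

/-- **G4-4 — the TRANSPORT HALF alone, no `HC_CM`**: `CMAnchoredFamilies ∧ [Buchweitz–Flenner 5.1] ∧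
UniformSemiregularSheafLiftAtCM ⟹ CMToAbelian` (the open route item stmt-HodgeConjecture-16267,
`HC_CM → ∀ A, IsSmoothProjective A.dim A.X → HodgeConjectureFor A.dim A.X`). So the uniform lift is a sufficient
condition for the item that carries the WHOLE content of "`HC_CM ⟹ HC_AV`" (`hc_av_iff_hc_cm_and_cmToAbelian`).
[cite: Deligne1982HodgeCycles, Prop. 6.1] [cite: BuchweitzFlenner2003, §5 Thm. 5.1] -/
theorem cmToAbelian_of_cmAnchoredFamilies_of_buchweitzFlenner_of_uniformSheafLift (C : ChernCharacterBetti)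
    (hMT : CMAnchoredFamilies) (hBF : BuchweitzFlenner2003_variationalHodge_ISemiregular)
    (hL : UniformSemiregularSheafLiftAtCM C) : Theses.RankFourFaces.CMToAbelian :=
  cmToAbelian_of_cmAnchoredFamilies_of_localVHCAtCM hMT
    (localVHCAtCM_of_buchweitzFlenner_of_uniformSheafLift C hBF hL)

/-! ### §4 Position of the hypothesis (what it is sufficient FOR, exactly) and the vacuity ledger in kernel form -/

/-- **G4-5 — POSITION (kernel-checked conjunction of tree theorems, no new content).** (a) the uniform lift + BF 5.1
give ring 2's CM-germ leaf `LocalVHCAtCM`; (b) granted Deligne 1982 Prop. 6.1 and Catanese 2002, that leaf is EXACTLY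
what `HC_CM` must be supplemented by: `CMToAbelian ↔ (HC_CM → LocalVHCAtCM)` (ring 2, binder seat b02/b08); (c)
`CMToAbelian ↔ (HC_CM → HodgeWeilType)` and (d) `HC_AV ↔ HodgeWeilType` (ring 2, transport seat): the Weil-type
reading of the target is `HC_AV` on the nose, so NO Weil-confined datum (the tables G1–G3: Weil CLASSES on Weil
components) can close it without a transport input of the strength of (b) — the uniform lift, in its all-families
form of §1, is such an input; its Weil-confined shadow is ring 2's `Ring2Transport.SemiregularChernLiftAtCMQuadratic`,
which reaches the Weil-class rung R∞ and HC(dim ≤ 5) only (`Ring2Transport.HC_WeilClassesQuadratic_of_HC_CM_of_semiregularChernLift`,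
`Ring2.Hypotheses.hc_dimLeFive_of_hc_cm_of_cmPointedQuadratic_of_localWeilVHCAtCM`). (e) `HC_AV ↔ HC_CM ∧ CMToAbelian`.
[cite: Deligne1982HodgeCycles, Prop. 6.1 and §4] [cite: Catanese2002DeformationTypes, §4 Thm. 4.1 and Thm. 4.6]
[cite: BuchweitzFlenner2003, §5 Thm. 5.1] -/
theorem generalStructure_position (C : ChernCharacterBetti) :
    (BuchweitzFlenner2003_variationalHodge_ISemiregular → UniformSemiregularSheafLiftAtCM C → LocalVHCAtCM) ∧
    (deligne1982_cmDenseMumfordTateFamilies → catanese2002_abelianFibres_of_abelianFibre →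
      (Theses.RankFourFaces.CMToAbelian ↔ (Theses.RankFourFaces.CMAbelianHodge → LocalVHCAtCM))) ∧
    (Theses.RankFourFaces.CMToAbelian ↔ (Theses.RankFourFaces.CMAbelianHodge → HodgeWeilType)) ∧
    (Theses.PadicSemiregularLift.HodgeAbelianVarieties ↔ HodgeWeilType) ∧
    (Theses.PadicSemiregularLift.HodgeAbelianVarieties ↔
      Theses.RankFourFaces.CMAbelianHodge ∧ Theses.RankFourFaces.CMToAbelian) :=
  ⟨localVHCAtCM_of_buchweitzFlenner_of_uniformSheafLift C,
    Ring2.Binders.cmToAbelian_iff_localVHCAtCM_of_hc_cm_of_deligne1982_of_catanese2002,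
    cmToAbelian_iff_hodgeWeilType_of_cmAbelianHodge, hodgeAbelianVarieties_iff_hodgeWeilType,
    hc_av_iff_hc_cm_and_cmToAbelian⟩

/-- **VACUITY LEDGER (i): every hypothesis of G4-2 EXCEPT the uniform lift is on-path or printed** — the summit gives
`HC_CM` (ring 2's `Ring2.Deform.HC_CM_of_hodgeConjecture`) and, with Catanese 2002, the CM-germ leaf itself (ring 2's
`Ring2.Binders.localVHCAtCM_of_hodgeConjecture_of_catanese2002`); the anchors are Deligne's printed theorem. Hence
`False` follows from the bundle only if it follows from `HodgeConjecture ∧` (Deligne 1982, Catanese 2002,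
Buchweitz–Flenner 2003) `∧ UniformSemiregularSheafLiftAtCM C`. The uniform lift itself has NO on-path lemma (its
conclusion asserts sheaves) — recorded, not provable. [cite: Deligne1982HodgeCycles, Prop. 6.1]
[cite: Catanese2002DeformationTypes, §4 Thm. 4.1 and Thm. 4.6] [cite: CharlesSchnell2014Notes, Cor. 11.3.6] -/
theorem bundle_sans_uniformLift_of_hodgeConjecture (h : _root_.HodgeConjecture)
    (hD : deligne1982_cmDenseMumfordTateFamilies) (hC : catanese2002_abelianFibres_of_abelianFibre) :
    Theses.RankFourFaces.CMAbelianHodge ∧ CMAnchoredFamilies ∧ LocalVHCAtCM ∧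
      Theses.PadicSemiregularLift.HodgeAbelianVarieties :=
  ⟨Ring2.Deform.HC_CM_of_hodgeConjecture h, Ring2.Deform.cmAnchoredFamilies_of_deligne1982 hD,
    Ring2.Binders.localVHCAtCM_of_hodgeConjecture_of_catanese2002 hC h, Ring2.Deform.HC_AV_of_hodgeConjecture h⟩

/-! ## Audit: nothing is decided here

Every theorem above whose conclusion is `HC_AV`, `HodgeWeilType` or `CMToAbelian` has among its hypotheses the team's
OPEN, SPECULATIVE statement `UniformSemiregularSheafLiftAtCM C` together with named printed facts (Deligne 1982
Prop. 6.1 or `CMAnchoredFamilies`; Buchweitz–Flenner 2003 Thm. 5.1) and — where load-bearing — `HC_CM` by name; or it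
is a conjunction of tree theorems. Axiom closures: the three standard axioms only. -/

#print axioms Summit.Ventures.HSemireg.GeneralStructure.localVHCAtCM_of_buchweitzFlenner_of_uniformSheafLift
#print axioms Summit.Ventures.HSemireg.GeneralStructure.hc_av_of_hc_cm_of_deligne1982_of_buchweitzFlenner_of_uniformSheafLift
#print axioms Summit.Ventures.HSemireg.GeneralStructure.hodgeWeilType_of_hc_cm_of_deligne1982_of_buchweitzFlenner_of_uniformSheafLift
#print axioms Summit.Ventures.HSemireg.GeneralStructure.generalStructure_position

end Summit.Ventures.HSemireg.GeneralStructure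

end
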